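import Literature.Topology.FourManifolds.ComplementaryFrameTransport
import Literature.Topology.FourManifolds.NormalRetraction
import HarnessLib

/-!
# A smooth frame of the tangent planes of an embedded manifold along a map from a compact
# convex parameter set (Milnor 1965, proof of Lemma 6.13: the frames over the Whitney disc `U'`)

Topic `Literature/Topology/FourManifolds`; bottom-layer input of **Lemma 6.13** of Milnor,
*Lectures on the h-cobordism theorem* (1965) (frame fields over the Whitney disc; the tree's leaf
`Literature.Topology.FourManifolds.Milnor1965_whitney_isotopy`, reduced in the tree to Lemma 6.7
in sheet form, `WhitneyModelSheets.lean`).  All three bundle arguments of the printed proof (PDF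
pp. 44–45: *"The bundle over `U'` of orthonormal `(r-1)`-frames orthogonal to `U'` is a trivial
bundle"*, *"… is a trivial bundle because `U'` is contractible"*) take place inside the tangent
bundle of `V` restricted to the disc `U'`; in a metric-free formalisation through a Whitney
embedding `e : V ⊆ ℝᴺ` (Mathlib's `exists_embedding_euclidean_of_compact`, the tree's normal
retraction `Literature.Topology.FourManifolds.exists_normalRetraction`) one first **frames the
tangent planes `T_{φ(u)} = de(T_{φ(u)} V) ⊆ ℝᴺ` smoothly in the parameter `u` of the disc**,
after which frames of `TV` along the disc are vectors of `ℝᴺ` with coordinates in `ℝⁿ`.  This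
file provides that framing, for any smooth map `φ` from an open set of a finite-dimensional
parameter space containing a compact convex `K` (the model disc `D̄ = {x² - 1 ≤ y ≤ 0}` is
compact and convex):

* `Literature.Topology.FourManifolds.exists_contDiffOn_tangentFrame` — on an open convex `W`,
  `K ⊆ W ⊆ U`, a `C^∞` family `Fr(u) : E →L ℝᴺ` (`E` the model space of `V`) of injective linear
  maps with `range Fr(u) = T_{φ(u)}`.

Proof: the orthogonal projections onto the tangent planes (the tree's
`Literature.Topology.FourManifolds.tangentProj`, smooth by `contMDiff_tangentProj`) form a smooth
family of idempotents along `φ`; transport the frame `de_{φ(c)}` from a centre `c ∈ K`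
(`Literature.Topology.FourManifolds.exists_contDiffOn_frame_of_projections`,
`ComplementaryFrameTransport.lean`).  Everything here is proved; no definitions, no named facts.

## References

* J. Milnor, *Lectures on the h-cobordism theorem*, notes by L. Siebenmann and J. Sondow,
  Princeton Mathematical Notes (1965), proof of Lemma 6.13 (PDF pp. 44–45). [MilnorHCobordism1965]
* M. W. Hirsch, *Differential Topology*, GTM 33 (1976), Ch. 4 §2, Cor. 2.5. [HirschDT1976]
-/

open Set Function Filter Module Metric
open scoped Manifold ContDiff Topology

noncomputable section

namespace Literature.Topology.FourManifolds

variable {E : Type*} [NormedAddCommGroup E] [InnerProductSpace ℝ E] [FiniteDimensional ℝ E]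
  {H : Type*} [TopologicalSpace H] {I : ModelWithCorners ℝ E H} [I.Boundaryless]
  {X : Type*} [TopologicalSpace X] [ChartedSpace H X] [IsManifold I ∞ X]
  {V : Type*} [NormedAddCommGroup V] [InnerProductSpace ℝ V] [FiniteDimensional ℝ V]
  {Y : Type*} [NormedAddCommGroup Y] [NormedSpace ℝ Y] [FiniteDimensional ℝ Y]

/-- **A smooth frame of the tangent planes of an immersed manifold along a map from a compact
convex parameter set** (the tangent bundle of `V ⊆ ℝᴺ` pulled back to the Whitney disc is
trivial; Milnor 1965, proof of Lemma 6.13, PDF pp. 44–45, Hirsch Ch. 4 §2 Cor. 2.5).  Let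
`e : X → V` be a `C^∞` map into a finite-dimensional inner product space with injective
differential everywhere, `φ : Y → X` a map from a finite-dimensional normed space, `C^∞` on an
open `U` containing a nonempty compact convex `K`.  Then on some open convex `W`, `K ⊆ W ⊆ U`,
there is a `C^∞` family `Fr : Y → (E →L V)` with `Fr u` injective and
`range (Fr u) = T_{φ u} = de(T_{φ u} X)` (so `Fr u` is fixed by the tangent projection
`Literature.Topology.FourManifolds.tangentProj I e (φ u)`) for every `u ∈ W`.
[cite: MilnorHCobordism1965, proof of Lemma 6.13 (PDF pp. 44–45)]
[cite: HirschDT1976, Ch. 4 §2, Cor. 2.5] -/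
theorem exists_contDiffOn_tangentFrame {e : X → V} (he : ContMDiff I 𝓘(ℝ, V) ∞ e)
    (hinj : ∀ x, Injective (mfderiv I 𝓘(ℝ, V) e x)) {K : Set Y} (hK : IsCompact K)
    (hKc : Convex ℝ K) (hKne : K.Nonempty) {U : Set Y} (hU : IsOpen U) (hKU : K ⊆ U)
    {φ : Y → X} (hφ : ContMDiffOn 𝓘(ℝ, Y) I ∞ φ U) :
    ∃ (W : Set Y) (Fr : Y → (E →L[ℝ] V)), IsOpen W ∧ Convex ℝ W ∧ K ⊆ W ∧ W ⊆ U ∧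
      ContDiffOn ℝ ∞ Fr W ∧
      ∀ u ∈ W, Injective (Fr u) ∧ (∀ w, tangentProj I e (φ u) (Fr u w) = Fr u w) ∧
        LinearMap.range (Fr u : E →ₗ[ℝ] V) = tangentPlane I e (φ u) := by
  -- the projection field along `φ`
  set P : Y → (V →L[ℝ] V) := fun u => tangentProj I e (φ u) with hP
  have hPd : ContDiffOn ℝ ∞ P U := by
    rw [← contMDiffOn_iff_contDiffOn]
    exact (contMDiff_tangentProj he hinj).comp_contMDiffOn hφ
  have hidem : ∀ u ∈ U, ∀ v, P u (P u v) = P u v := fun u _ v => tangentProj_idem e (φ u) v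
  -- the initial frame at a centre
  obtain ⟨c, hcK⟩ := hKne
  set B₀ : E →L[ℝ] V := mfderiv I 𝓘(ℝ, V) e (φ c) with hB₀
  have hB₀i : Injective B₀ := hinj (φ c)
  have hB₀f : ∀ w, P c (B₀ w) = B₀ w := fun w => tangentProj_mfderiv e (φ c) w
  obtain ⟨W, Fr, hWo, hWc, hKW, hWU, hFrd, hFr⟩ :=
    exists_contDiffOn_frame_of_projections hK hKc hU hKU hPd hidem hcK hB₀i hB₀f
  refine ⟨W, Fr, hWo, hWc, hKW, hWU, hFrd, fun u hu => ?_⟩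
  obtain ⟨hi, hfix⟩ := hFr u hu
  refine ⟨hi, hfix, ?_⟩
  -- `range (Fr u) ⊆ T_{φ u}`, with equal dimensions
  have hsub : LinearMap.range (Fr u : E →ₗ[ℝ] V) ≤ tangentPlane I e (φ u) := by
    rintro _ ⟨w, rfl⟩
    show Fr u w ∈ tangentPlane I e (φ u)
    rw [← hfix w]
    exact tangentProj_apply_mem e (φ u) _
  refine Submodule.eq_of_le_of_finrank_eq hsub ?_
  rw [LinearMap.finrank_range_of_inj hi,
    show finrank ℝ (tangentPlane I e (φ u)) = finrank ℝ E from
      LinearMap.finrank_range_of_inj (f := (mfderiv I 𝓘(ℝ, V) e (φ u)).toLinearMap) (hinj (φ u))]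

end Literature.Topology.FourManifolds
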